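import Mathlib

/-!
# Pinned-slope certificate (part 1/3): the `A₅`-slope of the door-(a) sections of length ≤ 7

Solo residency `solo-SmoothPoincare4-informed`, session 14; algebraic core of LEMMA 11.33 and of
COMPUTATION 11.38(a) (slope `x = c + 1`; words SStts, SSttS, SSTss, SStss, SSttttS, SSSStss) of the
residency file `paper/poincare-sphere-trick.md` §11.9 (prose results under adjudication, not
theorems of this tree).

Geometric provenance (prose + machine computation, not formalised here). `N_P = P ×_c S¹ ⊂ W = S³
×_c S¹` is the mapping torus of complex conjugation on the `c`-invariant punctured Klein bottle `P`
bounded by the trefoil; a cyclically reduced word `w` of odd length in `π₁(P) = F⟨s,t⟩` defines a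
section `γ_w ⊂ N_P`. A Dehn filling `N_P(γ_w; α)` with `π₁ ≅ ℤ` is a solid Klein bottle in `S⁴` and
yields an unknotting theorem for a Klein bottle in `S⁴`, hence the standardness of one half of a
Yoshikawa type of homotopy 4-spheres (§11 of the residency file). THEOREM 11.37 there (pseudo-Anosov
pinning) shows that only the three slopes at distance ≤ 1 from the degeneracy slope of the (pseudo-
Anosov) monodromy can give a solid Klein bottle; two of them are excluded by torsion in a 3-fold
cover, and the third, the 'fake slope' `x_* = c + 1` (homology `ℤ`, all small cyclic covers
homology-cyclic), by an `A₅`-quotient. The presentations below — six generators `a,b,c,d,e` (free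
generators of the fibre group `π₁(Σ_{1,4})`) and `y` (orientation-reversing), thirteen relators
(five `τ g τ⁻¹ = ĥ_w(g)` for the normalised monodromy `ĥ_w` and the filled stable letter `τ`, one
cusp relation, five `y g y⁻¹ = ι(g)`, `y² = ι²`, `y τ y⁻¹ = z τ`) — are the output of the residency
scripts `work/s14/fdtc.py`, `a5cert.py` for `π₁(N_P(γ_w; α_{x_*}))`, taken here as INPUT; what is
kernel-checked is that each presented group maps to `S₅` with non-commuting generator images
(explicit images of all six generators in `A₅`, every relator verified by `decide`), hence is non-
commutative and not isomorphic to `ℤ`.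

Also proved here (pure algebra, LEMMA 11.33 of the residency file): no additive map `ℤ → ℤ × ZMod d`
is surjective for `d ≥ 2` — geometrically, `H₁(N_P(γ_w; α))` surjects onto `H₁(N_P)/⟨Δ·[γ_w]⟩ ≅ ℤ ⊕
ℤ/Δ`, `Δ = Δ(α, μ)`, so a filling with `H₁ ≅ ℤ` has `Δ = 1` (only degree-one slopes can give solid
Klein bottles).
-/

set_option maxRecDepth 20000

namespace Summit.SmoothPoincare4.SmoothPoincare4.Theorems
namespace PinnedSlope

/-! ## LEMMA 11.33: `ℤ` does not surject onto `ℤ × ZMod d`, `d ≥ 2` -/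

/-- No additive map `ℤ → ℤ × ZMod d` (`d ≥ 2`) is surjective. -/
theorem not_surjective_int_to_int_prod_zmod (d : ℕ) (hd : 2 ≤ d) (f : ℤ →+ ℤ × ZMod d) :
    ¬ Function.Surjective f := by
  intro hf
  obtain ⟨n, hn⟩ := hf (1, 0)
  obtain ⟨m, hm⟩ := hf (0, 1)
  have h1 : ∀ k : ℤ, f k = k • f 1 := fun k => by
    rw [← map_zsmul, smul_eq_mul, mul_one]
  rw [h1] at hn hm
  have hn1 := congrArg Prod.fst hn
  have hm1 := congrArg Prod.fst hm
  have hm2 := congrArg Prod.snd hm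
  simp only [Prod.smul_fst, Prod.smul_snd, smul_eq_mul] at hn1 hm1 hm2
  have ha : (f 1).1 ≠ 0 := by
    intro h0
    rw [h0, mul_zero] at hn1
    exact zero_ne_one hn1
  have hm0 : m = 0 := by
    rcases mul_eq_zero.mp hm1 with h | h
    · exact h
    · exact absurd h ha
  rw [hm0, zero_zsmul] at hm2
  haveI : Fact (1 < d) := ⟨hd⟩
  exact zero_ne_one hm2


/-! ## Certificate machinery: six generators, relators as words, images in `S₅` -/

/-- A word in six generators: list of (generator, `true` = generator / `false` = inverse). -/
abbrev W : Type := List (Fin 6 × Bool)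

/-- generator `a` -/ abbrev a : Fin 6 × Bool := (0, true)
/-- inverse of `a` -/ abbrev A : Fin 6 × Bool := (0, false)
/-- generator `b` -/ abbrev b : Fin 6 × Bool := (1, true)
/-- inverse of `b` -/ abbrev B : Fin 6 × Bool := (1, false)
/-- generator `c` -/ abbrev c : Fin 6 × Bool := (2, true)
/-- inverse of `c` -/ abbrev C : Fin 6 × Bool := (2, false)
/-- generator `d` -/ abbrev d : Fin 6 × Bool := (3, true)
/-- inverse of `d` -/ abbrev D : Fin 6 × Bool := (3, false)
/-- generator `e` -/ abbrev e : Fin 6 × Bool := (4, true)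
/-- inverse of `e` -/ abbrev E : Fin 6 × Bool := (4, false)
/-- generator `y` -/ abbrev y : Fin 6 × Bool := (5, true)
/-- inverse of `y` -/ abbrev Y : Fin 6 × Bool := (5, false)

/-- Evaluate a word on a choice of six permutations. -/
def evalP (f : Fin 6 → Equiv.Perm (Fin 5)) (L : W) : Equiv.Perm (Fin 5) :=
  (L.map fun x => cond x.2 (f x.1) (f x.1)⁻¹).prod

/-- The relator set of a list of words. -/
def relSet (R : List W) : Set (FreeGroup (Fin 6)) := {g | ∃ L ∈ R, FreeGroup.mk L = g}

/-- The finitely presented group `⟨a₁,…,a₅,y ∣ R⟩`. -/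
abbrev G (R : List W) : Type := PresentedGroup (relSet R)

/-- A homomorphism `G R → S₅` from six permutations satisfying the relators. -/
def toPerm (R : List W) (f : Fin 6 → Equiv.Perm (Fin 5)) (h : ∀ L ∈ R, evalP f L = 1) :
    G R →* Equiv.Perm (Fin 5) :=
  PresentedGroup.toGroup (f := f) (by
    rintro r ⟨L, hL, rfl⟩
    rw [FreeGroup.lift_mk]
    exact h L hL)

/-- `toPerm` on generators. -/
@[simp] theorem toPerm_of (R : List W) (f : Fin 6 → Equiv.Perm (Fin 5)) (h : ∀ L ∈ R, evalP f L = 1)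
    (i : Fin 6) : toPerm R f h (PresentedGroup.of i) = f i := by
  simp [toPerm]

/-- If two generator images do not commute, the presented group is not commutative … -/
theorem of_mul_of_ne (R : List W) (f : Fin 6 → Equiv.Perm (Fin 5)) (h : ∀ L ∈ R, evalP f L = 1)
    (i j : Fin 6) (hij : f i * f j ≠ f j * f i) :
    (PresentedGroup.of i : G R) * PresentedGroup.of j ≠
      PresentedGroup.of j * PresentedGroup.of i := by
  intro hc
  have := congrArg (toPerm R f h) hc
  simp only [map_mul, toPerm_of] at this
  exact hij this

/-- … and in particular not isomorphic to `ℤ`. -/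
theorem isEmpty_mulEquiv_int (R : List W) (f : Fin 6 → Equiv.Perm (Fin 5))
    (h : ∀ L ∈ R, evalP f L = 1)
    (i j : Fin 6) (hij : f i * f j ≠ f j * f i) : IsEmpty (G R ≃* Multiplicative ℤ) := by
  refine ⟨fun q => of_mul_of_ne R f h i j hij ?_⟩
  apply q.injective
  rw [map_mul, map_mul, mul_comm]


/-! ## The fake-slope filling groups -/

/-- Relators of `π₁(N_P(γ_w; α_{c+1}))`, `w = SStts` (`|ĥ_w| = 108`). -/
def R_SStts : List W :=
  [[A, b, a, E, d, B, e, c, D, B, e, B, a, E, d, C, E, b, D, e],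
   [A, b, a, E, d, B, e, c, D, B, e, B, a, E, d, C, E, b, D, e],
   [A, b, c, B, a, E, d, B, e, c, D, D, b, d, C, B, d, e, A, b, c, D, B, e, B, a, E, d, C, E, b,
     D, e],
   [A, b, d, B, a, E, d, B, e, c, D, e, A, b, c, D, B, e, B, a, E, d, C, E, b, D, e],
   [A, b, e, B, a, E, d, B, e, c, D, e, A, b, E, d, B, e, B, a, E, d, C, E, b, D, e],
   [B, d, e, A, b, c, D, B, e, B, a, E, d, C, E, b, D, e, A, b, d, C],
   [y, a, Y, c, E],
   [y, b, Y, d, E],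
   [y, c, Y, a, E],
   [y, d, Y, b, E],
   [y, e, Y, E],
   [y, y, E],
   [y, A, b, Y, B, a, E, d, B, e, c, D, e, A, b, E, b, d, C, B, a, E, D, b]]

/-- Generator images in `A₅` for `w = SStts`. -/
def f_SStts : Fin 6 → Equiv.Perm (Fin 5) :=
  ![Equiv.swap 2 3 * Equiv.swap 3 4,
    Equiv.swap 2 4 * Equiv.swap 4 3,
    Equiv.swap 2 3 * Equiv.swap 3 4,
    Equiv.swap 0 1 * Equiv.swap 1 2 * Equiv.swap 2 3 * Equiv.swap 3 4,
    Equiv.swap 0 2 * Equiv.swap 2 3 * Equiv.swap 3 4 * Equiv.swap 4 1,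
    Equiv.swap 0 4 * Equiv.swap 4 2 * Equiv.swap 2 1 * Equiv.swap 1 3]

/-- Every relator of `R_SStts` holds for `f_SStts`. -/
theorem rels_SStts : ∀ L ∈ R_SStts, evalP f_SStts L = 1 := by decide

/-- Two generator images do not commute. -/
theorem nc_SStts : f_SStts 2 * f_SStts 3 ≠ f_SStts 3 * f_SStts 2 := by decide

/-- MAIN (SStts): the fake-slope filling group of `γ_w`, `w = SStts`, is not `ℤ`. -/
theorem isEmpty_G_SStts_mulEquiv_int : IsEmpty (G R_SStts ≃* Multiplicative ℤ) :=
  isEmpty_mulEquiv_int R_SStts f_SStts rels_SStts 2 3 nc_SStts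

/-- Relators of `π₁(N_P(γ_w; α_{c+1}))`, `w = SSttS` (`|ĥ_w| = 78`). -/
def R_SSttS : List W :=
  [[A, b, a, c, B, e, A, d, C, B, a, E, b, C],
   [A, b, a, c, B, e, A, d, C, B, a, E, b, C],
   [A, b, c, B, a, c, B, e, A, b, D, a, E, d, C, e, A, d, c, D, e, A, d, C, B, a, E, b, C],
   [A, b, d, B, a, c, B, e, A, b, c, D, e, A, d, C, B, a, E, b, C],
   [A, b, e, B, a, c, B, e, A, b, c, B, d, C, B, a, E, b, C],
   [e, A, d, c, D, e, A, d, C, B, a, E, b, C, A, b, d, C],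
   [y, a, Y, c, E],
   [y, b, Y, d, E],
   [y, c, Y, a, E],
   [y, d, Y, b, E],
   [y, e, Y, E],
   [y, y, E],
   [y, A, b, Y, B, a, c, B, e, A, b, c, D, a, E, d, C, D, a, E]]

/-- Generator images in `A₅` for `w = SSttS`. -/
def f_SSttS : Fin 6 → Equiv.Perm (Fin 5) :=
  ![Equiv.swap 0 2 * Equiv.swap 2 1 * Equiv.swap 1 4 * Equiv.swap 4 3,
    Equiv.swap 0 3 * Equiv.swap 1 2,
    Equiv.swap 2 3 * Equiv.swap 3 4,
    Equiv.swap 1 2 * Equiv.swap 2 3,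
    Equiv.swap 0 2 * Equiv.swap 2 1,
    Equiv.swap 0 1 * Equiv.swap 1 2]

/-- Every relator of `R_SSttS` holds for `f_SSttS`. -/
theorem rels_SSttS : ∀ L ∈ R_SSttS, evalP f_SSttS L = 1 := by decide

/-- Two generator images do not commute. -/
theorem nc_SSttS : f_SSttS 2 * f_SSttS 3 ≠ f_SSttS 3 * f_SSttS 2 := by decide

/-- MAIN (SSttS): the fake-slope filling group of `γ_w`, `w = SSttS`, is not `ℤ`. -/
theorem isEmpty_G_SSttS_mulEquiv_int : IsEmpty (G R_SSttS ≃* Multiplicative ℤ) :=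
  isEmpty_mulEquiv_int R_SSttS f_SSttS rels_SSttS 2 3 nc_SSttS

/-- Relators of `π₁(N_P(γ_w; α_{c+1}))`, `w = SSTss` (`|ĥ_w| = 80`). -/
def R_SSTss : List W :=
  [[A, b, a, E, D, e, B, d, e, A, b, E, D, E, d, e],
   [A, b, a, E, D, e, B, d, e, A, b, E, D, E, d, e],
   [A, b, c, B, a, E, D, e, B, e, d, C, E, b, e, B, d, e, A, b, E, D, E, d, e],
   [A, b, d, B, a, E, D, e, e, B, d, e, A, b, E, D, E, d, e],
   [A, b, e, B, a, E, D, e, d, B, e, c, D, E, d, e, A, b, E, D, E, d, e],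
   [E, b, e, B, d, e, A, b, E, D, E, d, e, A, b, d, C],
   [y, a, Y, c, E],
   [y, b, Y, d, E],
   [y, c, Y, a, E],
   [y, d, Y, b, E],
   [y, e, Y, E],
   [y, y, E],
   [y, A, b, Y, B, a, E, D, e, d, e, B, a, E, D, b, E, B, e]]

/-- Generator images in `A₅` for `w = SSTss`. -/
def f_SSTss : Fin 6 → Equiv.Perm (Fin 5) :=
  ![Equiv.swap 2 3 * Equiv.swap 3 4,
    Equiv.swap 1 4 * Equiv.swap 4 2,
    Equiv.swap 0 1 * Equiv.swap 1 2 * Equiv.swap 2 3 * Equiv.swap 3 4,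
    Equiv.swap 0 1 * Equiv.swap 1 2 * Equiv.swap 2 4 * Equiv.swap 4 3,
    Equiv.swap 0 3 * Equiv.swap 3 1 * Equiv.swap 1 2 * Equiv.swap 2 4,
    Equiv.swap 0 2 * Equiv.swap 2 3 * Equiv.swap 3 4 * Equiv.swap 4 1]

/-- Every relator of `R_SSTss` holds for `f_SSTss`. -/
theorem rels_SSTss : ∀ L ∈ R_SSTss, evalP f_SSTss L = 1 := by decide

/-- Two generator images do not commute. -/
theorem nc_SSTss : f_SSTss 0 * f_SSTss 3 ≠ f_SSTss 3 * f_SSTss 0 := by decide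

/-- MAIN (SSTss): the fake-slope filling group of `γ_w`, `w = SSTss`, is not `ℤ`. -/
theorem isEmpty_G_SSTss_mulEquiv_int : IsEmpty (G R_SSTss ≃* Multiplicative ℤ) :=
  isEmpty_mulEquiv_int R_SSTss f_SSTss rels_SSTss 0 3 nc_SSTss

/-- Relators of `π₁(N_P(γ_w; α_{c+1}))`, `w = SStss` (`|ĥ_w| = 92`). -/
def R_SStss : List W :=
  [[A, b, a, E, B, e, c, D, B, e, c, D, E, d, C, E, b, e],
   [A, b, a, E, B, e, c, D, B, e, c, D, E, d, C, E, b, e],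
   [A, b, c, B, a, E, B, e, c, D, e, B, a, E, D, e, d, C, E, d, e, A, e, c, D, E, d, C, E, b, e],
   [A, b, d, B, a, E, B, e, c, D, e, B, e, c, D, E, d, C, E, b, e],
   [A, b, e, B, a, E, B, e, c, e, A, b, E, B, e, c, D, E, d, C, E, b, e],
   [E, d, e, A, e, c, D, E, d, C, E, b, e, A, b, d, C],
   [y, a, Y, c, E],
   [y, b, Y, d, E],
   [y, c, Y, a, E],
   [y, d, Y, b, E],
   [y, e, Y, E],
   [y, y, E],
   [y, A, b, Y, B, a, E, B, e, c, D, e, d, C, E, a, E, D, e]]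

/-- Generator images in `A₅` for `w = SStss`. -/
def f_SStss : Fin 6 → Equiv.Perm (Fin 5) :=
  ![Equiv.swap 0 3 * Equiv.swap 1 2,
    Equiv.swap 1 3 * Equiv.swap 3 2,
    Equiv.swap 2 3 * Equiv.swap 3 4,
    Equiv.swap 0 1 * Equiv.swap 1 2 * Equiv.swap 2 3 * Equiv.swap 3 4,
    Equiv.swap 0 4 * Equiv.swap 4 1 * Equiv.swap 1 2 * Equiv.swap 2 3,
    Equiv.swap 0 2 * Equiv.swap 2 4 * Equiv.swap 4 3 * Equiv.swap 3 1]

/-- Every relator of `R_SStss` holds for `f_SStss`. -/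
theorem rels_SStss : ∀ L ∈ R_SStss, evalP f_SStss L = 1 := by decide

/-- Two generator images do not commute. -/
theorem nc_SStss : f_SStss 2 * f_SStss 3 ≠ f_SStss 3 * f_SStss 2 := by decide

/-- MAIN (SStss): the fake-slope filling group of `γ_w`, `w = SStss`, is not `ℤ`. -/
theorem isEmpty_G_SStss_mulEquiv_int : IsEmpty (G R_SStss ≃* Multiplicative ℤ) :=
  isEmpty_mulEquiv_int R_SStss f_SStss rels_SStss 2 3 nc_SStss

/-- Relators of `π₁(N_P(γ_w; α_{c+1}))`, `w = SSttttS` (`|ĥ_w| = 222`). -/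
def R_SSttttS : List W :=
  [[A, b, a, c, B, d, C, B, a, c, B, e, A, b, D, a, E, c, D, e, A, d, C, B, a, c, B, d, C, B, a,
     E, b, C, A, b, c, D, b, C],
   [A, b, a, c, B, d, C, B, a, c, B, e, A, b, D, a, E, c, D, e, A, d, C, B, a, c, B, d, C, B, a,
     E, b, C, A, b, c, D, b, C],
   [A, b, c, B, a, c, B, d, C, B, a, c, B, e, A, b, D, a, E, c, D, e, A, b, D, a, E, d, C, e, A,
     d, B, a, E, d, C, e, A, d, c, D, e, A, b, D, a, E, c, D, e, A, d, C, B, a, c, B, d, C, B, a,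
     E, b, C, A, b, c, D, b, C],
   [A, b, d, B, a, c, B, d, C, B, a, c, B, e, A, b, c, D, e, A, b, D, a, E, c, D, e, A, d, C, B,
     a, c, B, d, C, B, a, E, b, C, A, b, c, D, b, C],
   [A, b, e, B, a, c, B, d, C, B, a, c, B, e, A, b, c, D, b, C, A, b, c, B, d, C, B, a, c, B, d,
     C, B, a, E, b, C, A, b, c, D, b, C],
   [e, A, d, B, a, E, d, C, e, A, d, c, D, e, A, b, D, a, E, c, D, e, A, d, C, B, a, c, B, d, C,
     B, a, E, b, C, A, b, c, D, b, C, A, b, d, C],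
   [y, a, Y, c, E],
   [y, b, Y, d, E],
   [y, c, Y, a, E],
   [y, d, Y, b, E],
   [y, e, Y, E],
   [y, y, E],
   [y, A, b, Y, B, a, c, B, d, C, B, a, c, B, e, A, b, c, D, b, C, A, b, c, D, a, E, d, C, e, A,
     d, B, a, E, d, C, D, a, E, c, D, e, A, b, D, a, E]]

/-- Generator images in `A₅` for `w = SSttttS`. -/
def f_SSttttS : Fin 6 → Equiv.Perm (Fin 5) :=
  ![Equiv.swap 0 4 * Equiv.swap 4 1 * Equiv.swap 1 2 * Equiv.swap 2 3,
    Equiv.swap 1 3 * Equiv.swap 3 2,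
    1,
    Equiv.swap 0 1 * Equiv.swap 1 2 * Equiv.swap 2 3 * Equiv.swap 3 4,
    Equiv.swap 0 4 * Equiv.swap 4 1 * Equiv.swap 1 2 * Equiv.swap 2 3,
    Equiv.swap 0 2 * Equiv.swap 2 4 * Equiv.swap 4 3 * Equiv.swap 3 1]

/-- Every relator of `R_SSttttS` holds for `f_SSttttS`. -/
theorem rels_SSttttS : ∀ L ∈ R_SSttttS, evalP f_SSttttS L = 1 := by decide

/-- Two generator images do not commute. -/
theorem nc_SSttttS : f_SSttttS 3 * f_SSttttS 5 ≠ f_SSttttS 5 * f_SSttttS 3 := by decide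

/-- MAIN (SSttttS): the fake-slope filling group of `γ_w`, `w = SSttttS`, is not `ℤ`. -/
theorem isEmpty_G_SSttttS_mulEquiv_int : IsEmpty (G R_SSttttS ≃* Multiplicative ℤ) :=
  isEmpty_mulEquiv_int R_SSttttS f_SSttttS rels_SSttttS 3 5 nc_SSttttS

/-- Relators of `π₁(N_P(γ_w; α_{c+1}))`, `w = SSSStss` (`|ĥ_w| = 216`). -/
def R_SSSStss : List W :=
  [[A, b, a, E, B, e, c, D, e, B, a, E, D, e, d, C, E, d, e, A, e, c, D, E, d, C, E, b, e, A, b,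
     E, B, e, c, D, E, d, C, E, b, e],
   [A, b, a, E, B, e, c, D, e, B, a, E, D, e, d, C, E, d, e, A, e, c, D, E, d, C, E, b, e, A, b,
     E, B, e, c, D, E, d, C, E, b, e],
   [A, b, c, B, a, E, B, e, c, D, e, B, a, E, D, e, d, C, E, d, e, A, b, e, B, a, E, D, e, d, C,
     E, d, e, A, e, c, D, E, d, C, E, b, e, A, b, E, B, e, c, D, E, d, C, E, b, e],
   [A, b, d, B, a, E, B, e, c, D, e, e, B, a, E, D, e, d, C, E, d, e, A, e, c, D, E, d, C, E, b,
     e, A, b, E, B, e, c, D, E, d, C, E, b, e],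
   [A, b, e, B, a, E, B, e, c, D, e, d, C, E, b, e, B, a, E, B, e, c, e, A, b, E, B, e, c, D, E,
     d, C, E, b, e, A, b, E, B, e, c, D, E, d, C, E, b, e],
   [E, d, e, A, b, e, B, a, E, D, e, d, C, E, d, e, A, e, c, D, E, d, C, E, b, e, A, b, E, B, e,
     c, D, E, d, C, E, b, e, A, b, d, C],
   [y, a, Y, c, E],
   [y, b, Y, d, E],
   [y, c, Y, a, E],
   [y, d, Y, b, E],
   [y, e, Y, E],
   [y, y, E],
   [y, A, b, Y, B, a, E, B, e, c, D, e, d, C, E, b, e, B, a, E, B, e, c, D, e, d, C, E, a, E, D,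
     e, c, D, E, d, e, A, b, E, B, a, E, D, e]]

/-- Generator images in `A₅` for `w = SSSStss`. -/
def f_SSSStss : Fin 6 → Equiv.Perm (Fin 5) :=
  ![Equiv.swap 0 1 * Equiv.swap 2 3,
    Equiv.swap 1 3 * Equiv.swap 3 4,
    Equiv.swap 0 1 * Equiv.swap 1 2 * Equiv.swap 2 3 * Equiv.swap 3 4,
    Equiv.swap 0 2 * Equiv.swap 2 4 * Equiv.swap 4 3 * Equiv.swap 3 1,
    Equiv.swap 0 4 * Equiv.swap 4 3 * Equiv.swap 3 1 * Equiv.swap 1 2,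
    Equiv.swap 0 1 * Equiv.swap 1 4 * Equiv.swap 4 2 * Equiv.swap 2 3]

/-- Every relator of `R_SSSStss` holds for `f_SSSStss`. -/
theorem rels_SSSStss : ∀ L ∈ R_SSSStss, evalP f_SSSStss L = 1 := by decide

/-- Two generator images do not commute. -/
theorem nc_SSSStss : f_SSSStss 2 * f_SSSStss 3 ≠ f_SSSStss 3 * f_SSSStss 2 := by decide

/-- MAIN (SSSStss): the fake-slope filling group of `γ_w`, `w = SSSStss`, is not `ℤ`. -/
theorem isEmpty_G_SSSStss_mulEquiv_int : IsEmpty (G R_SSSStss ≃* Multiplicative ℤ) :=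
  isEmpty_mulEquiv_int R_SSSStss f_SSSStss rels_SSSStss 2 3 nc_SSSStss
end PinnedSlope
end Summit.SmoothPoincare4.SmoothPoincare4.Theorems
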